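/- LEAD seat `ym-line-cbag-p1` (prover-ym-line-cbag-p1-g28-0), LINE 7 `GlueballBandRecursion`: the WHOLE LINE from the one registered XL stub —
`Band.IsolatedBandFrame` implies the P1 item `OneParticleBlochSymbolFamily`, the three cruxes K1/K2/K3′ and the rung
`ColdDoublingRecursionStrongCoupling` by landed theorems only (door `…FamilyOfIsolatedBand`, discharged shells `…IsolatedBandShells`, and the route's
`…RungOfBlochSymbol`).  One-line compositions; route-dependent (imports `…RungOfBlochSymbol`); a helper. -/
import Summits.QuantumFields.YangMills.Theorems.GlueballBandRecursionFamilyOfIsolatedBand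
import Summits.QuantumFields.YangMills.Theorems.GlueballBandRecursionIsolatedBandShells
import Summits.QuantumFields.YangMills.Theorems.GlueballBandRecursionRungOfBlochSymbol

/-!
# Route `GlueballBandRecursion`: the line hangs on one stub — `IsolatedBandFrame` ⇒ family ⇒ K1 ∧ K2 ∧ K3′ ⇒ rung

* `effectiveBlochSymbolFamily_of_isolatedBandFrame'` : `IsolatedBandFrame → EffectiveBlochSymbolFamily` (shells discharged);
* `oneParticleBlochSymbolFamily_of_isolatedBandFrame` : `IsolatedBandFrame → Theses.GlueballBandRecursion.OneParticleBlochSymbolFamily` (item 22957);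
* `oneGlueballBandDichotomy_/thermalMultiplicityUpper_/gapStableUnderRefinement_of_isolatedBandFrame` (items 27554 / 27507 / 27508);
* `coldDoublingRecursionStrongCoupling_of_isolatedBandFrame` : `IsolatedBandFrame → Cruxes.IR.ColdPurityBridge.ColdDoublingRecursionStrongCoupling`.

HONEST FRAMING.  Conditional one-liners; the XL stub `IsolatedBandFrame` (periodic-torus, N-uniform one-glueball band — a cluster expansion not in
print) is NOT proved, so none of the item, the cruxes or the rung is; the rung is RECORD-type at STRONG coupling and nothing here bears on the Yang–Mills
mass gap / the summit `YangMills`.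
-/

set_option autoImplicit false

noncomputable section

namespace Summit.QuantumFields.YangMills.Theorems.GlueballBandRecursion.Band

open Summit.QuantumFields.YangMills.Theses.GlueballBandRecursion

/-- The effective Bloch symbol family from the isolated band frame ALONE (the two pure shells being theorems). -/
theorem effectiveBlochSymbolFamily_of_isolatedBandFrame' (h : IsolatedBandFrame) : EffectiveBlochSymbolFamily :=
  effectiveBlochSymbolFamily_of_isolatedBandFrame h symbolRegularityShell_holds upperGapPropagation_holds

/-- Item ⟨stmt-QuantumFields-22957⟩ from the stub. -/
theorem oneParticleBlochSymbolFamily_of_isolatedBandFrame (h : IsolatedBandFrame) : OneParticleBlochSymbolFamily :=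
  effectiveBlochSymbolFamily_of_isolatedBandFrame' h

/-- Crux K3′ ⟨stmt-QuantumFields-27554⟩ from the stub. -/
theorem oneGlueballBandDichotomy_of_isolatedBandFrame (h : IsolatedBandFrame) : OneGlueballBandDichotomy :=
  oneGlueballBandDichotomy_of_effectiveBlochSymbolFamily (effectiveBlochSymbolFamily_of_isolatedBandFrame' h)

/-- Crux K2 ⟨stmt-QuantumFields-27507⟩ from the stub. -/
theorem thermalMultiplicityUpper_of_isolatedBandFrame (h : IsolatedBandFrame) : ThermalMultiplicityUpper :=
  thermalMultiplicityUpper_of_effectiveBlochSymbolFamily (effectiveBlochSymbolFamily_of_isolatedBandFrame' h)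

/-- Crux K1 ⟨stmt-QuantumFields-27508⟩ from the stub. -/
theorem gapStableUnderRefinement_of_isolatedBandFrame (h : IsolatedBandFrame) : GapStableUnderRefinement :=
  gapStableUnderRefinement_of_effectiveBlochSymbolFamily (effectiveBlochSymbolFamily_of_isolatedBandFrame' h)

/-- **The rung from the stub**: `IsolatedBandFrame → ColdDoublingRecursionStrongCoupling` (RECORD-type, strong coupling). -/
theorem coldDoublingRecursionStrongCoupling_of_isolatedBandFrame (h : IsolatedBandFrame) :
    Summit.QuantumFields.YangMills.Cruxes.IR.ColdPurityBridge.ColdDoublingRecursionStrongCoupling :=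
  coldDoublingRecursionStrongCoupling_of_effectiveBlochSymbolFamily (effectiveBlochSymbolFamily_of_isolatedBandFrame' h)

end Summit.QuantumFields.YangMills.Theorems.GlueballBandRecursion.Band

end
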